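import Summits.ValiantsHypothesis.ValiantsHypothesis.Theorems.NcHankelIntervalBound
import HarnessLib

/-!
# Non-skew depth of shapes, the abstract designation game, heights and the goodness bridge — H3a of O-L6-20 (T2)

T2 of O-L6-20 turns the Hankel interval instrument (`hankel_interval_bound`, H2b) into the rung
«PERM is hard for circuits of non-skew depth `k`» (LMS16 Theorem 1.3 / FLOS20 Theorem 20 in the
kernel). THIS FILE (generic, mask-agnostic): (§1) the NON-SKEW DEPTH `nsd` of a parse-tree shape —
the largest number of nodes with BOTH children internal (non-skew product gates) on a root-to-leaf
path (LMS16's non-skew depth read on shapes; a skew circuit has all parse trees of `nsd = 0`);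
(§2) the ABSTRACT DESIGNATION GAME `des_ne_none_of_inv`: a position/budget invariant `Inv x y j`
that survives a skew step in `x`, a skew step in `y` and — for one of the two children — a
non-skew split, and excludes the two-leaf node, forces `des good S x ≠ none` on every shape of
`nsd ≤ j` (structural induction; the three transition hypotheses are discharged for the tilted
sawtooth in `NcSawtoothDesignation`); (§3) HEIGHTS `hgt Y i = Σ_{j<i} (±1)` of a position set and
the GOODNESS BRIDGE `ivGood_of_le`: for a balanced position set, an interval whose height
increment is `≥ g` in absolute value is `(|A| − g)`-close to `A` or to `Aᶜ` (FLOS20 §3.2 distance;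
`hamming_ivInd`, `hamming_bnot_ivInd` are the two pointwise counting identities).
MODEL (verbatim for every file): «Circuits ArithCircuit K σ read in FreeAlgebra K σ (ncEval), K a
field, σ finite; weighted sum gates of any fan-in, product gates of fan-in 1 or 2 (general fan-in:
the landed binz of O-L6-19); the INPUT circuit of a rung is const-free with non-constant output
(print: homogenisation, HWY10 §2 / LMS16 Lemma 4.2 — not formalised; same clause as
ncPerPoly_uptPrint); the instrument (H2) is proved in the wider ZERO-CONST model (const operands
allowed iff 0) so that block substitutions with vanishing entries stay inside it.»
print-KNOWN (LMS16 §3, §6; FLOS20 Theorem 5, §5) · kernel-NEW · INSTRUMENT · 0 S-currency ·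
closes NO item · A_nc stmt-23446 / PerNotNcVP / VP ≠ VNP untouched.
[cite: LimayeMalodSrinivasan2016, Theorem 1.3, §3 (non-skew depth), Lemma 4.2]
[cite: FijalkowLagardeOhlmannSerre2020, Theorem 5 (p. 7–8), §3.2, Theorem 13 (p. 12), Theorem 20]
[cite: LagardeLimayeSrinivasan2018, §2 (parse trees)]
-/

noncomputable section

namespace Summit.ValiantsHypothesis.ValiantsHypothesis.Theorems.NcNonSkewDepthShapes

set_option linter.dupNamespace false
open Summit.ValiantsHypothesis.ValiantsHypothesis.Theorems.NcUniqueParseTree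
  Summit.ValiantsHypothesis.ValiantsHypothesis.Theorems.NcParseTrees
  Summit.ValiantsHypothesis.ValiantsHypothesis.Theorems.NcPartialDerivative
  Summit.ValiantsHypothesis.ValiantsHypothesis.Theorems.NcHankelIntervalModel
  Summit.ValiantsHypothesis.ValiantsHypothesis.Theorems.NcHankelIntervalBound

/-! ### §1 Non-skew depth of a shape -/

/-- Internal node test. [cite: LimayeMalodSrinivasan2016, §3] -/
def isNode : Shape → Bool
  | .leaf => false
  | .node _ _ => true

/-- **Non-skew depth** of a shape: the maximum over root-to-leaf paths of the number of nodes both of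
whose children are internal (= non-skew product gates of the parse tree).
[cite: LimayeMalodSrinivasan2016, §3] -/
def nsd : Shape → ℕ
  | .leaf => 0
  | .node l r => max (nsd l) (nsd r) + (if isNode l && isNode r then 1 else 0)

/-- A node with a leaf on the left costs nothing. [cite: LimayeMalodSrinivasan2016, §3] -/
theorem nsd_leaf_node (r : Shape) : nsd (.node .leaf r) = nsd r := by
  simp [nsd, isNode]

/-- A node with a leaf on the right costs nothing. [cite: LimayeMalodSrinivasan2016, §3] -/
theorem nsd_node_leaf (l : Shape) : nsd (.node l .leaf) = nsd l := by
  simp [nsd, isNode]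

/-- A node with two internal children costs one. [cite: LimayeMalodSrinivasan2016, §3] -/
theorem nsd_node_node (a b c d : Shape) :
    nsd (.node (.node a b) (.node c d)) = max (nsd (.node a b)) (nsd (.node c d)) + 1 := by
  simp [nsd, isNode]

/-! ### §2 The abstract designation game -/

/-- **The designation game.** If an invariant `Inv x y j` ("the node on `[x,y)` with remaining
non-skew budget `j` is still losing for the circuit") excludes the two-leaf node, and from a node
whose own interval is not good passes to the child of a skew step (`x ↦ x+1` or `y ↦ y−1`, same
budget) and to ONE child of a non-skew split (budget `j−1`) unless that child's interval is good,
then every shape of non-skew depth `≤ j` placed on an invariant interval is designated.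
[cite: FijalkowLagardeOhlmannSerre2020, Theorem 5] -/
theorem des_ne_none_of_inv (good : ℕ → ℕ → Bool) (Inv : ℕ → ℕ → ℕ → Prop)
    (h2 : ∀ x j, Inv x (x + 2) j → good x 2 = true)
    (hx : ∀ x m j, 2 ≤ m → Inv x (x + (1 + m)) j → good x (1 + m) = false →
      good (x + 1) m = true ∨ Inv (x + 1) (x + 1 + m) j)
    (hy : ∀ x m j, 2 ≤ m → Inv x (x + (m + 1)) j → good x (m + 1) = false →
      good x m = true ∨ Inv x (x + m) j)
    (hs : ∀ x m₁ m₂ j, 2 ≤ m₁ → 2 ≤ m₂ → Inv x (x + (m₁ + m₂)) (j + 1) →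
      good x (m₁ + m₂) = false →
      (good x m₁ = true ∨ Inv x (x + m₁) j) ∨ (good (x + m₁) m₂ = true ∨ Inv (x + m₁) (x + m₁ + m₂) j)) :
    ∀ S : Shape, 2 ≤ S.size → ∀ x j : ℕ, nsd S ≤ j → Inv x (x + S.size) j → des good S x ≠ none := by
  intro S
  induction S with
  | leaf => intro h; change 2 ≤ 1 at h; omega
  | node l r ihl ihr =>
    intro _ x j hj hI
    -- a node whose own interval is good is designated at its root
    have root : ∀ (a b : Shape) (z : ℕ), good z (a.size + b.size) = true →
        des good (.node a b) z ≠ none := fun a b z h => by simp [des, h]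
    by_cases hg : good x (l.size + r.size) = true
    · exact root l r x hg
    have hg' : good x (l.size + r.size) = false := by simpa using hg
    have step : des good l x ≠ none ∨ des good r (x + l.size) ≠ none →
        des good (.node l r) x ≠ none := by
      intro h
      simp only [des, hg', Bool.false_eq_true, ↓reduceIte, ne_eq]
      cases hdl : des good l x with
      | some J => simp
      | none => rw [Option.none_or]; exact h.elim (fun h' => absurd hdl h') id
    cases l with
    | leaf =>
      cases r with
      | leaf =>
        simp only [Shape.size, Nat.reduceAdd] at hI hg'
        exact absurd (h2 x j hI) (by simp [hg'])
      | node c d =>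
        simp only [Shape.size] at hI hg'
        rw [nsd_leaf_node] at hj
        have hc := (length_nodes c).2
        have hd := (length_nodes d).2
        rcases hx x (c.size + d.size) j (by omega) hI hg' with h | h
        · exact step (Or.inr (root c d (x + 1) h))
        · exact step (Or.inr (ihr (by simp only [Shape.size]; omega) (x + 1) j hj
            (by simpa only [Shape.size] using h)))
    | node a b =>
      have ha := (length_nodes a).2
      have hb := (length_nodes b).2
      cases r with
      | leaf =>
        simp only [Shape.size] at hI hg'
        rw [nsd_node_leaf] at hj
        rcases hy x (a.size + b.size) j (by omega) hI hg' with h | h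
        · exact step (Or.inl (root a b x h))
        · exact step (Or.inl (ihl (by simp only [Shape.size]; omega) x j hj
            (by simpa only [Shape.size] using h)))
      | node c d =>
        simp only [Shape.size] at hI hg'
        rw [nsd_node_node] at hj
        have hc := (length_nodes c).2
        have hd := (length_nodes d).2
        obtain ⟨j', rfl⟩ : ∃ j', j = j' + 1 := ⟨j - 1, by omega⟩
        have hjl : nsd (.node a b) ≤ j' := by
          have := le_max_left (nsd (.node a b)) (nsd (.node c d)); omega
        have hjr : nsd (.node c d) ≤ j' := by
          have := le_max_right (nsd (.node a b)) (nsd (.node c d)); omega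
        rcases hs x (a.size + b.size) (c.size + d.size) j' (by omega) (by omega) hI hg' with
          (h | h) | (h | h)
        · exact step (Or.inl (root a b x h))
        · exact step (Or.inl (ihl (by simp only [Shape.size]; omega) x j' hjl
            (by simpa only [Shape.size] using h)))
        · exact step (Or.inr (root c d (x + (a.size + b.size)) h))
        · exact step (Or.inr (ihr (by simp only [Shape.size]; omega) (x + (a.size + b.size)) j' hjr
            (by simpa only [Shape.size] using h)))

/-! ### §3 Heights of a position set and the goodness bridge -/

/-- The HEIGHT of the position set `A = {Y = true}` below `i`: `#(A ∩ [0,i)) − #(Aᶜ ∩ [0,i))`.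
[cite: FijalkowLagardeOhlmannSerre2020, §3.2] -/
def hgt {d : ℕ} (Y : Fin d → Bool) (i : ℕ) : ℤ :=
  ∑ j : Fin d, if j.val < i then (if Y j = true then (1 : ℤ) else -1) else 0

/-- [cite: FijalkowLagardeOhlmannSerre2020, §3.2] -/
theorem hgt_zero {d : ℕ} (Y : Fin d → Bool) : hgt Y 0 = 0 := by
  simp [hgt]

/-- One more position: `h(i+1) = h(i) ± 1`. [cite: FijalkowLagardeOhlmannSerre2020, §3.2] -/
theorem hgt_succ {d : ℕ} (Y : Fin d → Bool) {i : ℕ} (hi : i < d) :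
    hgt Y (i + 1) = hgt Y i + (if Y ⟨i, hi⟩ = true then 1 else -1) := by
  have key : ∀ j : Fin d, (if j.val < i + 1 then (if Y j = true then (1 : ℤ) else -1) else 0) =
      (if j.val < i then (if Y j = true then (1 : ℤ) else -1) else 0) +
        (if j = ⟨i, hi⟩ then (if Y j = true then (1 : ℤ) else -1) else 0) := by
    intro j
    by_cases hji : j = ⟨i, hi⟩
    · subst hji; simp
    · have hne : j.val ≠ i := fun h => hji (Fin.ext h)
      by_cases hlt : j.val < i
      · rw [if_pos (by omega), if_pos hlt, if_neg hji, add_zero]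
      · rw [if_neg (by omega), if_neg hlt, if_neg hji, add_zero]
  unfold hgt
  rw [Finset.sum_congr rfl fun j _ => key j, Finset.sum_add_distrib, Fintype.sum_ite_eq']

/-- `|A Δ [a,a+m)| = |A| − (h(a+m) − h(a))` (pointwise). [cite: FijalkowLagardeOhlmannSerre2020, Lemma 9] -/
theorem hamming_ivInd {d : ℕ} (Y : Fin d → Bool) (a m : ℕ) :
    (hamming Y (ivInd d a m) : ℤ) =
      Fintype.card {i : Fin d // Y i = true} - (hgt Y (a + m) - hgt Y a) := by
  rw [hamming, Fintype.card_subtype, Finset.card_filter, Finset.card_filter]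
  push_cast
  rw [hgt, hgt, ← Finset.sum_sub_distrib, ← Finset.sum_sub_distrib]
  refine Finset.sum_congr rfl fun i _ => ?_
  by_cases hI : a ≤ i.val ∧ i.val < a + m
  · have hv : ivInd d a m i = true := decide_eq_true hI
    rw [if_pos hI.2, if_neg (show ¬ i.val < a by omega)]
    rcases Bool.eq_false_or_eq_true (Y i) with hY | hY <;> simp [hY, hv]
  · have hv : ivInd d a m i = false := decide_eq_false hI
    by_cases h₂ : i.val < a + m
    · rw [if_pos h₂, if_pos (show i.val < a by omega)]
      rcases Bool.eq_false_or_eq_true (Y i) with hY | hY <;> simp [hY, hv]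
    · rw [if_neg h₂, if_neg (show ¬ i.val < a by omega)]
      rcases Bool.eq_false_or_eq_true (Y i) with hY | hY <;> simp [hY, hv]

/-- `|Aᶜ Δ [a,a+m)| = |Aᶜ| + (h(a+m) − h(a))` (pointwise). [cite: FijalkowLagardeOhlmannSerre2020, Lemma 9] -/
theorem hamming_bnot_ivInd {d : ℕ} (Y : Fin d → Bool) (a m : ℕ) :
    (hamming (bnot Y) (ivInd d a m) : ℤ) =
      Fintype.card {i : Fin d // Y i = false} + (hgt Y (a + m) - hgt Y a) := by
  rw [hamming, Fintype.card_subtype, Finset.card_filter, Finset.card_filter]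
  push_cast
  rw [hgt, hgt, ← Finset.sum_sub_distrib, ← Finset.sum_add_distrib]
  refine Finset.sum_congr rfl fun i _ => ?_
  by_cases hI : a ≤ i.val ∧ i.val < a + m
  · have hv : ivInd d a m i = true := decide_eq_true hI
    rw [if_pos hI.2, if_neg (show ¬ i.val < a by omega)]
    rcases Bool.eq_false_or_eq_true (Y i) with hY | hY <;> simp [hY, hv, bnot]
  · have hv : ivInd d a m i = false := decide_eq_false hI
    by_cases h₂ : i.val < a + m
    · rw [if_pos h₂, if_pos (show i.val < a by omega)]
      rcases Bool.eq_false_or_eq_true (Y i) with hY | hY <;> simp [hY, hv, bnot]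
    · rw [if_neg h₂, if_neg (show ¬ i.val < a by omega)]
      rcases Bool.eq_false_or_eq_true (Y i) with hY | hY <;> simp [hY, hv, bnot]

/-- **Goodness bridge**: if `|A|, |Aᶜ| ≤ δ + g`, an interval with `|h(a+m) − h(a)| ≥ g` is `δ`-close
to `A` or to `Aᶜ`, i.e. GOOD for `ivGood Y δ`. [cite: FijalkowLagardeOhlmannSerre2020, Theorem 13] -/
theorem ivGood_of_le {d : ℕ} (Y : Fin d → Bool) {δ g : ℕ}
    (hP : Fintype.card {i : Fin d // Y i = true} ≤ δ + g)
    (hQ : Fintype.card {i : Fin d // Y i = false} ≤ δ + g) {a m : ℕ}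
    (h : (g : ℤ) ≤ |hgt Y (a + m) - hgt Y a|) : ivGood Y δ a m = true := by
  have h₁ := hamming_ivInd Y a m
  have h₂ := hamming_bnot_ivInd Y a m
  simp only [ivGood, bdist, decide_eq_true_eq]
  rcases le_abs'.1 h with h' | h'
  · refine (min_le_right _ _).trans ?_
    have : (hamming (bnot Y) (ivInd d a m) : ℤ) ≤ δ := by omega
    exact_mod_cast this
  · refine (min_le_left _ _).trans ?_
    have : (hamming Y (ivInd d a m) : ℤ) ≤ δ := by omega
    exact_mod_cast this

end Summit.ValiantsHypothesis.ValiantsHypothesis.Theorems.NcNonSkewDepthShapes
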